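import Summits.Ventures.QEC.Census.BB.BB72.InfoSetZ1
import Summits.Ventures.QEC.Census.BB.BB72.InfoSetZ2
import Summits.Ventures.QEC.Census.CertChunks
import HarnessLib

/-!
# `BB72` — KERNEL-tier lower bound, side Z, information-set certificate, file 3/3 (qec-search-7)

Label-free information-set certificate (Census/CertInfoSet.lean + CertInfoSetSound.lean, PARTITION v2.2 item
07.IS) for side Z of the certificate `7e943c5a566adc43`: the syndrome matrix `cert.HX` (36 rows, rank 30) in reduced
row-echelon form — 30 pivot columns `piv`, reduced rows `red` (each the XOR of the listed original rows, `comb`) — and the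
standard kernel basis of its 42 free columns; every XOR of between 1 and 5 basis vectors has ≥ 6 set bits
(974981 XORs in 42 first-generator chunks, each one `decide +kernel`; test word `hasBits6`). Consequence
(`DistCert.dZ_code_of_infoSet`): every nonzero `v : Fin 72 → ZMod 2` with `cert.HX · v = 0` has weight ≥ 6 — the lower
half of `d_Z = 6`. Tier KERNEL (CERTIFIED): axioms ⊆ {propext, Classical.choice, Quot.sound}. Data computed by
HOME/census/search-7/emit_infoset.py from the certificate's `HX`; the emitter's row reduction is NOT trusted
(`isZ_struct` re-checks pivots and decompositions in the kernel).
This file: chunks 11 … 41 (206367 XORs) and the assembled statement `isZ_reaches`.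
-/

namespace Summit.Ventures.QEC.Census.BB72

/-- Chunk 11: every XOR of ≤ 5 kernel-basis vectors whose first vector is basis vector 11 has ≥ 6 set bits (31931 XORs). -/
theorem isZ_c11 : ichunk hasBits6 (kerBasis 72 isZ.piv isZ.red) 3 11 = true := by decide +kernel

/-- Chunk 12: every XOR of ≤ 5 kernel-basis vectors whose first vector is basis vector 12 has ≥ 6 set bits (27841 XORs). -/
theorem isZ_c12 : ichunk hasBits6 (kerBasis 72 isZ.piv isZ.red) 3 12 = true := by decide +kernel

/-- Chunk 13: every XOR of ≤ 5 kernel-basis vectors whose first vector is basis vector 13 has ≥ 6 set bits (24158 XORs). -/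
theorem isZ_c13 : ichunk hasBits6 (kerBasis 72 isZ.piv isZ.red) 3 13 = true := by decide +kernel

/-- Chunk 14: every XOR of ≤ 5 kernel-basis vectors whose first vector is basis vector 14 has ≥ 6 set bits (20854 XORs). -/
theorem isZ_c14 : ichunk hasBits6 (kerBasis 72 isZ.piv isZ.red) 3 14 = true := by decide +kernel

/-- Chunk 15: every XOR of ≤ 5 kernel-basis vectors whose first vector is basis vector 15 has ≥ 6 set bits (17902 XORs). -/
theorem isZ_c15 : ichunk hasBits6 (kerBasis 72 isZ.piv isZ.red) 3 15 = true := by decide +kernel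

/-- Chunk 16: every XOR of ≤ 5 kernel-basis vectors whose first vector is basis vector 16 has ≥ 6 set bits (15276 XORs). -/
theorem isZ_c16 : ichunk hasBits6 (kerBasis 72 isZ.piv isZ.red) 3 16 = true := by decide +kernel

/-- Chunk 17: every XOR of ≤ 5 kernel-basis vectors whose first vector is basis vector 17 has ≥ 6 set bits (12951 XORs). -/
theorem isZ_c17 : ichunk hasBits6 (kerBasis 72 isZ.piv isZ.red) 3 17 = true := by decide +kernel

/-- Chunk 18: every XOR of ≤ 5 kernel-basis vectors whose first vector is basis vector 18 has ≥ 6 set bits (10903 XORs). -/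
theorem isZ_c18 : ichunk hasBits6 (kerBasis 72 isZ.piv isZ.red) 3 18 = true := by decide +kernel

/-- Chunk 19: every XOR of ≤ 5 kernel-basis vectors whose first vector is basis vector 19 has ≥ 6 set bits (9109 XORs). -/
theorem isZ_c19 : ichunk hasBits6 (kerBasis 72 isZ.piv isZ.red) 3 19 = true := by decide +kernel

/-- Chunk 20: every XOR of ≤ 5 kernel-basis vectors whose first vector is basis vector 20 has ≥ 6 set bits (7547 XORs). -/
theorem isZ_c20 : ichunk hasBits6 (kerBasis 72 isZ.piv isZ.red) 3 20 = true := by decide +kernel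

/-- Chunk 21: every XOR of ≤ 5 kernel-basis vectors whose first vector is basis vector 21 has ≥ 6 set bits (6196 XORs). -/
theorem isZ_c21 : ichunk hasBits6 (kerBasis 72 isZ.piv isZ.red) 3 21 = true := by decide +kernel

/-- Chunk 22: every XOR of ≤ 5 kernel-basis vectors whose first vector is basis vector 22 has ≥ 6 set bits (5036 XORs). -/
theorem isZ_c22 : ichunk hasBits6 (kerBasis 72 isZ.piv isZ.red) 3 22 = true := by decide +kernel

/-- Chunk 23: every XOR of ≤ 5 kernel-basis vectors whose first vector is basis vector 23 has ≥ 6 set bits (4048 XORs). -/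
theorem isZ_c23 : ichunk hasBits6 (kerBasis 72 isZ.piv isZ.red) 3 23 = true := by decide +kernel

/-- Chunk 24: every XOR of ≤ 5 kernel-basis vectors whose first vector is basis vector 24 has ≥ 6 set bits (3214 XORs). -/
theorem isZ_c24 : ichunk hasBits6 (kerBasis 72 isZ.piv isZ.red) 3 24 = true := by decide +kernel

/-- Chunk 25: every XOR of ≤ 5 kernel-basis vectors whose first vector is basis vector 25 has ≥ 6 set bits (2517 XORs). -/
theorem isZ_c25 : ichunk hasBits6 (kerBasis 72 isZ.piv isZ.red) 3 25 = true := by decide +kernel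

/-- Chunk 26: every XOR of ≤ 5 kernel-basis vectors whose first vector is basis vector 26 has ≥ 6 set bits (1941 XORs). -/
theorem isZ_c26 : ichunk hasBits6 (kerBasis 72 isZ.piv isZ.red) 3 26 = true := by decide +kernel

/-- Chunk 27: every XOR of ≤ 5 kernel-basis vectors whose first vector is basis vector 27 has ≥ 6 set bits (1471 XORs). -/
theorem isZ_c27 : ichunk hasBits6 (kerBasis 72 isZ.piv isZ.red) 3 27 = true := by decide +kernel

/-- Chunk 28: every XOR of ≤ 5 kernel-basis vectors whose first vector is basis vector 28 has ≥ 6 set bits (1093 XORs). -/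
theorem isZ_c28 : ichunk hasBits6 (kerBasis 72 isZ.piv isZ.red) 3 28 = true := by decide +kernel

/-- Chunk 29: every XOR of ≤ 5 kernel-basis vectors whose first vector is basis vector 29 has ≥ 6 set bits (794 XORs). -/
theorem isZ_c29 : ichunk hasBits6 (kerBasis 72 isZ.piv isZ.red) 3 29 = true := by decide +kernel

/-- Chunk 30: every XOR of ≤ 5 kernel-basis vectors whose first vector is basis vector 30 has ≥ 6 set bits (562 XORs). -/
theorem isZ_c30 : ichunk hasBits6 (kerBasis 72 isZ.piv isZ.red) 3 30 = true := by decide +kernel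

/-- Chunk 31: every XOR of ≤ 5 kernel-basis vectors whose first vector is basis vector 31 has ≥ 6 set bits (386 XORs). -/
theorem isZ_c31 : ichunk hasBits6 (kerBasis 72 isZ.piv isZ.red) 3 31 = true := by decide +kernel

/-- Chunk 32: every XOR of ≤ 5 kernel-basis vectors whose first vector is basis vector 32 has ≥ 6 set bits (256 XORs). -/
theorem isZ_c32 : ichunk hasBits6 (kerBasis 72 isZ.piv isZ.red) 3 32 = true := by decide +kernel

/-- Chunk 33: every XOR of ≤ 5 kernel-basis vectors whose first vector is basis vector 33 has ≥ 6 set bits (163 XORs). -/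
theorem isZ_c33 : ichunk hasBits6 (kerBasis 72 isZ.piv isZ.red) 3 33 = true := by decide +kernel

/-- Chunk 34: every XOR of ≤ 5 kernel-basis vectors whose first vector is basis vector 34 has ≥ 6 set bits (99 XORs). -/
theorem isZ_c34 : ichunk hasBits6 (kerBasis 72 isZ.piv isZ.red) 3 34 = true := by decide +kernel

/-- Chunk 35: every XOR of ≤ 5 kernel-basis vectors whose first vector is basis vector 35 has ≥ 6 set bits (57 XORs). -/
theorem isZ_c35 : ichunk hasBits6 (kerBasis 72 isZ.piv isZ.red) 3 35 = true := by decide +kernel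

/-- Chunk 36: every XOR of ≤ 5 kernel-basis vectors whose first vector is basis vector 36 has ≥ 6 set bits (31 XORs). -/
theorem isZ_c36 : ichunk hasBits6 (kerBasis 72 isZ.piv isZ.red) 3 36 = true := by decide +kernel

/-- Chunk 37: every XOR of ≤ 5 kernel-basis vectors whose first vector is basis vector 37 has ≥ 6 set bits (16 XORs). -/
theorem isZ_c37 : ichunk hasBits6 (kerBasis 72 isZ.piv isZ.red) 3 37 = true := by decide +kernel

/-- Chunk 38: every XOR of ≤ 5 kernel-basis vectors whose first vector is basis vector 38 has ≥ 6 set bits (8 XORs). -/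
theorem isZ_c38 : ichunk hasBits6 (kerBasis 72 isZ.piv isZ.red) 3 38 = true := by decide +kernel

/-- Chunk 39: every XOR of ≤ 5 kernel-basis vectors whose first vector is basis vector 39 has ≥ 6 set bits (4 XORs). -/
theorem isZ_c39 : ichunk hasBits6 (kerBasis 72 isZ.piv isZ.red) 3 39 = true := by decide +kernel

/-- Chunk 40: every XOR of ≤ 5 kernel-basis vectors whose first vector is basis vector 40 has ≥ 6 set bits (2 XORs). -/
theorem isZ_c40 : ichunk hasBits6 (kerBasis 72 isZ.piv isZ.red) 3 40 = true := by decide +kernel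

/-- Chunk 41: every XOR of ≤ 5 kernel-basis vectors whose first vector is basis vector 41 has ≥ 6 set bits (1 XORs). -/
theorem isZ_c41 : ichunk hasBits6 (kerBasis 72 isZ.piv isZ.red) 3 41 = true := by decide +kernel

/-- **Side Z of `BB72`, tier KERNEL**: every XOR of between 1 and 5 kernel-basis vectors of the reduced
`cert.HX` has at least 6 set bits (assembled from the 42 chunks). -/
theorem isZ_reaches : DReaches hasBits6 (kerBasis 72 isZ.piv isZ.red) 4 0 :=
  dreaches_of_ichunks 42 _ 3 (by decide +kernel)
    (forall_lt_append (forall_lt_append (forall_lt_append (forall_lt_append (forall_lt_append (forall_lt_append (forall_lt_append (forall_lt_append (forall_lt_append (forall_lt_append (forall_lt_append (forall_lt_append (forall_lt_append (forall_lt_append (forall_lt_append (forall_lt_append (forall_lt_append (forall_lt_append (forall_lt_append (forall_lt_append (forall_lt_append (forall_lt_append (forall_lt_append (forall_lt_append (forall_lt_append (forall_lt_append (forall_lt_append (forall_lt_append (forall_lt_append (forall_lt_append (forall_lt_append (forall_lt_append (forall_lt_append (forall_lt_append (forall_lt_append (forall_lt_append (forall_lt_append (forall_lt_append (forall_lt_append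 (forall_lt_append (forall_lt_append (forall_lt_append (forall_lt_zero) (forall_lt_single 0 isZ_c0)) (forall_lt_single 1 isZ_c1)) (forall_lt_single 2 isZ_c2)) (forall_lt_single 3 isZ_c3)) (forall_lt_single 4 isZ_c4)) (forall_lt_single 5 isZ_c5)) (forall_lt_single 6 isZ_c6)) (forall_lt_single 7 isZ_c7)) (forall_lt_single 8 isZ_c8)) (forall_lt_single 9 isZ_c9)) (forall_lt_single 10 isZ_c10)) (forall_lt_single 11 isZ_c11)) (forall_lt_single 12 isZ_c12)) (forall_lt_single 13 isZ_c13)) (forall_lt_single 14 isZ_c14)) (forall_lt_single 15 isZ_c15)) (forall_lt_single 16 isZ_c16)) (forall_lt_single 17 isZ_c17)) (forall_lt_single 18 isZ_c18)) (forall_lt_single 19 isZ_c19)) (forall_lt_single 20 isZ_c20)) (forall_lt_single 21 isZ_c21)) (forall_lt_single 22 isZ_c22)) (forall_lt_single 23 isZ_c23)) (forall_lt_single 24 isZ_c24)) (forall_lt_single 25 isZ_c25)) (forall_lt_single 26 isZ_c26)) (forall_lt_single 27 isZ_c27)) (forall_lt_single 28 isZ_c28)) (forall_lt_single 29 isZ_c29))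 (forall_lt_single 30 isZ_c30)) (forall_lt_single 31 isZ_c31)) (forall_lt_single 32 isZ_c32)) (forall_lt_single 33 isZ_c33)) (forall_lt_single 34 isZ_c34)) (forall_lt_single 35 isZ_c35)) (forall_lt_single 36 isZ_c36)) (forall_lt_single 37 isZ_c37)) (forall_lt_single 38 isZ_c38)) (forall_lt_single 39 isZ_c39)) (forall_lt_single 40 isZ_c40)) (forall_lt_single 41 isZ_c41))

/-- **`d_Z = 6` for `BB72` by the information-set certificate, tier KERNEL** (CERTIFIED: axioms ⊆ {propext,
Classical.choice, Quot.sound}): the structural check of the distance certificate (upper witness; inline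
`decide +kernel`) + `isZ_struct` + `isZ_reaches` through `DistCert.dZ_code_of_infoSet`. -/
theorem dZ_eq_infoSet : (cert.code (cert.commOK_of_checkStructure (by decide +kernel))).dZ = 6 :=
  cert.dZ_code_of_infoSet (by decide +kernel) isZ isZ_struct (fun x hx hxn => le_popc_of_hasBits6 hx hxn) isZ_reaches (by decide)

end Summit.Ventures.QEC.Census.BB72
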